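import Summits.Ventures.HSemireg.WedgeHankelClassSpaceIrreducibleCharP
import Mathlib.Algebra.Lie.Sl2

/-!
# Venture HSemireg — THE INFINITESIMAL SUBSTITUTIONS: the raising operator `e E_i = (i+1) E_{i+1}`, the lowering operator `f E_i = (n−i+1) E_{i−1}` and the weight operator
# `h E_i = (2i − n) E_i` on th-7's class space form an `sl₂`-TRIPLE (`ef − fe = h`, `he − eh = 2e`, `hf − fh = −2f`; Mathlib's `IsSl2Triple` for the commutator bracket when `n ≠ 0` in `K`), the point class `E_n` is
# a PRIMITIVE VECTOR of weight `n`, `e^k E_i = (i+1)⋯(i+k) E_{i+k}` so `e^{n+1} = 0`, and the torus `SbC(a 0 0 d)` commutes with `h` — uniform in `n`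

HONEST FRAMING. Part of the Lean index of the computation cell `pub-hsemireg` (seat p10 gen 22, Sunday typer «UNIFORM-IN-n»).
Finite-dimensional EXTERIOR ALGEBRA + linear algebra + Lie brackets of endomorphisms ONLY: no variety, no cohomology theory, no sheaf, no Ext group, no semiregularity map;
nothing here says that HC / HC_CM / HC_AV holds; no Literature fact is declared or used.  Custodian versions as in `WedgeHankelSiegelIdeal` (1/3) and `WedgeHankelFrameChange`;
the dictionary (the class space = `Sym^n` of the letters' plane = the `(n+1)`-dimensional representation of `sl₂`; `e = x∂_y`, `f = y∂_x`, `h = x∂_x − y∂_y` up to normalisation;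
the shear `SbC(1 λ 0 1) = exp(λe)` when `n!` is a unit) is QUOTED, never asserted.

WHAT IS IN THE TREE.  The GROUP side: H1/J5 `SbC g` for every `2 × 2` matrix `g` (`SbC_mul`), K3 `SbC_diag_spikeBasis` (`SbC(a 0 0 d) E_i = a^{n−i}d^i E_i`), `repr_SbC_spikeBasis` +
I9 `sbMat_shear_apply` (`SbC(1 λ 0 1) E_i = Σ_{a ≥ i} C(a,i) λ^{a−i} E_a`), K1 `repr_SbC_shear_sub_one_pow_spikeBasis` (leading term `(i+1)⋯(i+k)λ^k E_{i+k}` of `(S−1)^k E_i`), K13/K22/K23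
(centralizers); Mathlib `IsSl2Triple`, `IsSl2Triple.HasPrimitiveVectorWith`.  No INFINITESIMAL generator was typed.  THIS FILE (namespace `Summit.Ventures.HSemireg.Wedge.HankelFrameChange`
continued; imports K3 + `Mathlib.Algebra.Lie.Sl2`) types the Lie-algebra side, for endomorphisms `e f h` of th-7's class space GIVEN by their values on the spikes (hypotheses `hE`,
`hEtop`, `hF`, `hF0`, `hH`; such `e f h` exist and are unique, §331):
* §331 `exists_raising` / `exists_lowering` / `exists_weight` (existence via `Basis.constr`), `raising_unique` (two endomorphisms with the raising values agree).
* §332 THE RELATIONS: **`commutator_raising_lowering`** (`ef − fe = h`: on `E_i` the coefficient `(n−i+1)i − (i+1)(n−i) = 2i − n`), **`commutator_weight_raising`** (`he − eh = 2 • e`),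
  **`commutator_weight_lowering`** (`hf − fh = −(2 • f)`), `weight_ne_zero` (`n ≠ 0` in `K` ⇒ `h ≠ 0`), **`isSl2Triple_spikes`: `IsSl2Triple h e f`** for the commutator bracket
  (Mathlib's `LieRing.ofAssociativeRing`, supplied explicitly since it is not a global instance; `n ≠ 0` in `K`), **`spike_top_primitive`** (`E_n` is a highest-weight vector of weight
  `n`: `e E_n = 0`, `h E_n = n • E_n`), `weight_spikeBasis_zero` (`E_0`: weight `−n`, `f E_0 = 0`).
* §333 POWERS AND THE TORUS: **`pow_raising_spikeBasis_of_le`** (`e^k E_i = (i+1)⋯(i+k) • E_{i+k}`, `i + k ≤ n`), **`pow_raising_spikeBasis_eq_zero`** (`i + k > n`),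
  **`raising_pow_succ_eq_zero`** (`e^{n+1} = 0`), `raising_pow_ne_zero_of_factorial` (`e^n E_0 = n!·E_n ≠ 0` when `n! ≠ 0`), **`commute_SbC_diag_weight`** (`SbC(a 0 0 d)·h = h·SbC(a 0 0 d)`:
  the torus lies in the centralizer of `h`).
NOT typed here: `SbC(1 λ 0 1) = Σ_k (λ^k/k!) e^k` (`n!` a unit; next leaf), the lower shear as `exp(c f)`, the Casimir, complete reducibility consequences from Mathlib's `sl₂` theory;
anything Ext-side.  New names only.
-/

open Module

namespace Summit.Ventures.HSemireg.Wedge.HankelFrameChange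

open Summit.Ventures.HSemireg.Wedge Summit.Ventures.HSemireg.Wedge.Kunneth Summit.Ventures.HSemireg.Wedge.Hankel
  Summit.Ventures.HSemireg.Wedge.BasisFree Summit.Ventures.HSemireg.Wedge.HankelSiegel Summit.Ventures.HSemireg.Wedge.HankelSiegelIdeal
  Summit.Ventures.HSemireg.Wedge.KunnethKernel Summit.Ventures.HSemireg.Wedge.HankelRankOne Summit.Ventures.HSemireg.Wedge.KernelDuality

variable (K : Type*) [Field K] {n : ℕ}

/-! ## §331. The raising, lowering and weight operators exist (and are determined by their values on the spikes) -/

/-- **a RAISING operator exists: `e E_i = (i+1) E_{i+1}` (`i < n`), `e E_n = 0`.** -/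
theorem exists_raising : ∃ e : Module.End K (spikeSpan K n),
    (∀ (i : Fin (n + 1)) (hi : (i : ℕ) < n), e (spikeBasis K n i) = (((i : ℕ) : K) + 1) • spikeBasis K n ⟨(i : ℕ) + 1, by omega⟩) ∧ e (spikeBasis K n (Fin.last n)) = 0 := by
  classical
  refine ⟨(spikeBasis K n).constr K fun i : Fin (n + 1) => if hi : (i : ℕ) < n then (((i : ℕ) : K) + 1) • spikeBasis K n ⟨(i : ℕ) + 1, by omega⟩ else 0, fun i hi => ?_, ?_⟩
  · rw [Basis.constr_basis, dif_pos hi]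
  · rw [Basis.constr_basis, dif_neg (by rw [Fin.val_last]; omega)]

/-- **a LOWERING operator exists: `f E_i = (n−i+1) E_{i−1}` (`i > 0`), `f E_0 = 0`.** -/
theorem exists_lowering : ∃ f : Module.End K (spikeSpan K n),
    (∀ (i : Fin (n + 1)) (hi : 0 < (i : ℕ)), f (spikeBasis K n i) = ((n : K) - (i : ℕ) + 1) • spikeBasis K n ⟨(i : ℕ) - 1, by omega⟩) ∧ f (spikeBasis K n 0) = 0 := by
  classical
  refine ⟨(spikeBasis K n).constr K fun i : Fin (n + 1) => if hi : 0 < (i : ℕ) then ((n : K) - (i : ℕ) + 1) • spikeBasis K n ⟨(i : ℕ) - 1, by omega⟩ else 0, fun i hi => ?_, ?_⟩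
  · rw [Basis.constr_basis, dif_pos hi]
  · rw [Basis.constr_basis, dif_neg (by simp)]

/-- **the WEIGHT operator exists: `h E_i = (2i − n) E_i`.** -/
theorem exists_weight : ∃ h : Module.End K (spikeSpan K n), ∀ i : Fin (n + 1), h (spikeBasis K n i) = (2 * ((i : ℕ) : K) - n) • spikeBasis K n i := by
  classical
  exact ⟨(spikeBasis K n).constr K fun i : Fin (n + 1) => (2 * ((i : ℕ) : K) - n) • spikeBasis K n i, fun i => Basis.constr_basis _ _ _ _⟩

/-- the raising values determine the operator. -/
theorem raising_unique {e e' : Module.End K (spikeSpan K n)}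
    (hE : ∀ (i : Fin (n + 1)) (hi : (i : ℕ) < n), e (spikeBasis K n i) = (((i : ℕ) : K) + 1) • spikeBasis K n ⟨(i : ℕ) + 1, by omega⟩) (hEtop : e (spikeBasis K n (Fin.last n)) = 0)
    (hE' : ∀ (i : Fin (n + 1)) (hi : (i : ℕ) < n), e' (spikeBasis K n i) = (((i : ℕ) : K) + 1) • spikeBasis K n ⟨(i : ℕ) + 1, by omega⟩) (hEtop' : e' (spikeBasis K n (Fin.last n)) = 0) :
    e = e' := by
  refine (spikeBasis K n).ext fun i => ?_
  by_cases hi : (i : ℕ) < n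
  · rw [hE i hi, hE' i hi]
  · have ei : i = Fin.last n := Fin.ext (by rw [Fin.val_last]; have := i.2; omega)
    rw [ei, hEtop, hEtop']

/-! ## §332. The `sl₂` relations and the primitive vector -/

section Triple

variable {e f h : Module.End K (spikeSpan K n)}
  (hE : ∀ (i : Fin (n + 1)) (hi : (i : ℕ) < n), e (spikeBasis K n i) = (((i : ℕ) : K) + 1) • spikeBasis K n ⟨(i : ℕ) + 1, by omega⟩) (hEtop : e (spikeBasis K n (Fin.last n)) = 0)
  (hF : ∀ (i : Fin (n + 1)) (hi : 0 < (i : ℕ)), f (spikeBasis K n i) = ((n : K) - (i : ℕ) + 1) • spikeBasis K n ⟨(i : ℕ) - 1, by omega⟩) (hF0 : f (spikeBasis K n 0) = 0)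
  (hH : ∀ i : Fin (n + 1), h (spikeBasis K n i) = (2 * ((i : ℕ) : K) - n) • spikeBasis K n i)

include hEtop in
/-- `e E_i = 0` at `i = n` (the boundary case of `hE`). -/
theorem raising_apply_of_not_lt (i : Fin (n + 1)) (hi : ¬ (i : ℕ) < n) : e (spikeBasis K n i) = 0 := by
  have ei : i = Fin.last n := Fin.ext (by rw [Fin.val_last]; have := i.2; omega)
  rw [ei, hEtop]

include hF0 in
/-- `f E_i = 0` at `i = 0`. -/
theorem lowering_apply_of_not_pos (i : Fin (n + 1)) (hi : ¬ 0 < (i : ℕ)) : f (spikeBasis K n i) = 0 := by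
  have ei : i = 0 := Fin.ext (by simp only [Fin.val_zero]; omega)
  rw [ei, hF0]

include hE hEtop hF hF0 hH in
/-- **`e·f − f·e = h`**: on `E_i`, `e(f E_i) − f(e E_i) = [(n−i+1)·i − (i+1)·(n−i)] E_i = (2i − n) E_i`. -/
theorem commutator_raising_lowering : e * f - f * e = h := by
  refine (spikeBasis K n).ext fun i => ?_
  rw [LinearMap.sub_apply, Module.End.mul_apply, Module.End.mul_apply, hH]
  -- `e (f E_i)`
  have h1 : e (f (spikeBasis K n i)) = (((n : K) - (i : ℕ) + 1) * (i : ℕ)) • spikeBasis K n i := by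
    by_cases hi : 0 < (i : ℕ)
    · rw [hF i hi, map_smul, hE ⟨(i : ℕ) - 1, by omega⟩ (by simp only; omega), smul_smul]
      have e2 : (⟨(((⟨(i : ℕ) - 1, by omega⟩ : Fin (n + 1)) : ℕ)) + 1, by simp only; omega⟩ : Fin (n + 1)) = i := Fin.ext (by simp only; omega)
      rw [e2]
      congr 1
      rw [show ((((⟨(i : ℕ) - 1, by omega⟩ : Fin (n + 1)) : ℕ) : ℕ) : K) + 1 = ((i : ℕ) : K) by
        simp only; rw [Nat.cast_sub (by omega), Nat.cast_one, sub_add_cancel]]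
    · rw [lowering_apply_of_not_pos K hF0 i hi, map_zero, show ((i : ℕ) : K) = 0 by rw [show (i : ℕ) = 0 by omega, Nat.cast_zero], mul_zero, zero_smul]
  -- `f (e E_i)`
  have h2 : f (e (spikeBasis K n i)) = ((((i : ℕ) : K) + 1) * ((n : K) - (i : ℕ))) • spikeBasis K n i := by
    by_cases hi : (i : ℕ) < n
    · rw [hE i hi, map_smul, hF ⟨(i : ℕ) + 1, by omega⟩ (by simp only; omega), smul_smul]
      have e2 : (⟨(((⟨(i : ℕ) + 1, by omega⟩ : Fin (n + 1)) : ℕ)) - 1, by simp only; omega⟩ : Fin (n + 1)) = i := Fin.ext (by simp only; omega)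
      rw [e2]
      congr 1
      simp only [Nat.cast_add, Nat.cast_one]
      ring
    · rw [raising_apply_of_not_lt K hEtop i hi, map_zero, show ((n : K) - (i : ℕ)) = 0 by rw [show (i : ℕ) = n by have := i.2; omega, sub_self], mul_zero, zero_smul]
  rw [h1, h2]
  module

include hE hEtop hH in
/-- **`h·e − e·h = 2 • e`**: `h(e E_i) − e(h E_i) = (i+1)[(2(i+1) − n) − (2i − n)] E_{i+1} = 2(i+1) E_{i+1}`. -/
theorem commutator_weight_raising : h * e - e * h = 2 • e := by
  rw [two_nsmul]
  refine (spikeBasis K n).ext fun i => ?_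
  rw [LinearMap.sub_apply, Module.End.mul_apply, Module.End.mul_apply, LinearMap.add_apply, hH, map_smul]
  by_cases hi : (i : ℕ) < n
  · rw [hE i hi, map_smul, hH, smul_smul, smul_smul]
    simp only [Nat.cast_add, Nat.cast_one]
    module
  · rw [raising_apply_of_not_lt K hEtop i hi, map_zero, smul_zero, sub_zero, add_zero]

include hF hF0 hH in
/-- **`h·f − f·h = −(2 • f)`**: `h(f E_i) − f(h E_i) = (n−i+1)[(2(i−1) − n) − (2i − n)] E_{i−1} = −2(n−i+1) E_{i−1}`. -/
theorem commutator_weight_lowering : h * f - f * h = -(2 • f) := by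
  rw [two_nsmul]
  refine (spikeBasis K n).ext fun i => ?_
  rw [LinearMap.sub_apply, Module.End.mul_apply, Module.End.mul_apply, LinearMap.neg_apply, LinearMap.add_apply, hH, map_smul]
  by_cases hi : 0 < (i : ℕ)
  · rw [hF i hi, map_smul, hH, smul_smul, smul_smul]
    simp only [Nat.cast_sub (show 1 ≤ (i : ℕ) from hi), Nat.cast_one]
    module
  · rw [lowering_apply_of_not_pos K hF0 i hi, map_zero, smul_zero, sub_zero, add_zero, neg_zero]

include hH in
/-- `n ≠ 0` in `K` ⇒ `h ≠ 0` (`h E_0 = −n E_0`). -/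
theorem weight_ne_zero (hn : (n : K) ≠ 0) : h ≠ 0 := by
  intro h0
  have h1 := hH 0
  rw [h0, LinearMap.zero_apply, eq_comm, smul_eq_zero] at h1
  rcases h1 with h1 | h1
  · rw [Fin.val_zero, Nat.cast_zero, mul_zero, zero_sub, neg_eq_zero] at h1
    exact hn h1
  · exact (spikeBasis K n).ne_zero 0 h1

include hE hEtop hF hF0 hH in
/-- **THE `sl₂`-TRIPLE ON TH-7's CLASS SPACE: `IsSl2Triple h e f`** for the commutator bracket (Mathlib's `LieRing.ofAssociativeRing` on `End`, a non-global instance there, supplied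
explicitly here; `n ≠ 0` in `K`, so that `h ≠ 0`; every field). -/
theorem isSl2Triple_spikes (hn : (n : K) ≠ 0) : @IsSl2Triple (Module.End K (spikeSpan K n)) LieRing.ofAssociativeRing h e f :=
  @IsSl2Triple.mk (Module.End K (spikeSpan K n)) LieRing.ofAssociativeRing h e f (weight_ne_zero K hH hn)
    (commutator_raising_lowering K hE hEtop hF hF0 hH) (commutator_weight_raising K hE hEtop hH) (commutator_weight_lowering K hF hF0 hH)

include hEtop hH in
/-- **THE POINT CLASS `E_n` IS A PRIMITIVE (HIGHEST-WEIGHT) VECTOR OF WEIGHT `n`: `e E_n = 0`, `h E_n = n • E_n`.** -/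
theorem spike_top_primitive : e (spikeBasis K n (Fin.last n)) = 0 ∧ h (spikeBasis K n (Fin.last n)) = (n : K) • spikeBasis K n (Fin.last n) := by
  refine ⟨hEtop, ?_⟩
  rw [hH, Fin.val_last]
  congr 1
  ring

include hF0 hH in
/-- the pure class `E_0` is a LOWEST-weight vector: `f E_0 = 0`, `h E_0 = −n • E_0`. -/
theorem weight_spikeBasis_zero : f (spikeBasis K n 0) = 0 ∧ h (spikeBasis K n 0) = -(n : K) • spikeBasis K n 0 := by
  refine ⟨hF0, ?_⟩
  rw [hH, Fin.val_zero, Nat.cast_zero, mul_zero, zero_sub]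

/-! ## §333. Powers of the raising operator; the torus commutes with the weight operator -/

include hE in
/-- **`e^k E_i = (i+1)(i+2)⋯(i+k) • E_{i+k}`** for `i + k ≤ n` (`= (i+1).ascFactorial k`). -/
theorem pow_raising_spikeBasis_of_le (i : Fin (n + 1)) {k : ℕ} (hik : (i : ℕ) + k ≤ n) :
    (e ^ k) (spikeBasis K n i) = ((((i : ℕ) + 1).ascFactorial k : ℕ) : K) • spikeBasis K n ⟨(i : ℕ) + k, by omega⟩ := by
  induction k with
  | zero =>
    rw [pow_zero, Module.End.one_apply, Nat.ascFactorial_zero, Nat.cast_one, one_smul]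
    rfl
  | succ k ih =>
    rw [pow_succ', Module.End.mul_apply, ih (by omega), map_smul, hE ⟨(i : ℕ) + k, by omega⟩ (by simp only; omega), smul_smul, Nat.ascFactorial_succ, Nat.cast_mul]
    have e2 : (⟨(((⟨(i : ℕ) + k, by omega⟩ : Fin (n + 1)) : ℕ)) + 1, by simp only; omega⟩ : Fin (n + 1)) = ⟨(i : ℕ) + (k + 1), by omega⟩ := Fin.ext (by simp only; omega)
    rw [e2]
    congr 1
    push_cast
    ring

include hE hEtop in
/-- **`e^k E_i = 0` for `i + k > n`.** -/
theorem pow_raising_spikeBasis_eq_zero (i : Fin (n + 1)) {k : ℕ} (hik : n < (i : ℕ) + k) : (e ^ k) (spikeBasis K n i) = 0 := by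
  induction k with
  | zero => omega
  | succ k ih =>
    rw [pow_succ', Module.End.mul_apply]
    by_cases hk : n < (i : ℕ) + k
    · rw [ih hk, map_zero]
    · rw [pow_raising_spikeBasis_of_le K hE i (by omega), map_smul, raising_apply_of_not_lt K hEtop _ (by simp only; omega), smul_zero]

include hE hEtop in
/-- **the raising operator is nilpotent: `e^{n+1} = 0`.** -/
theorem raising_pow_succ_eq_zero : e ^ (n + 1) = 0 :=
  (spikeBasis K n).ext fun i => by rw [LinearMap.zero_apply, pow_raising_spikeBasis_eq_zero K hE hEtop i (by omega)]

include hE in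
/-- `e^n E_0 = n! • E_n`; hence `e^n ≠ 0` when `n! ≠ 0` in `K` (the nilpotency index is exactly `n + 1`). -/
theorem raising_pow_ne_zero_of_factorial (hfac : ((n.factorial : ℕ) : K) ≠ 0) : e ^ n ≠ 0 := by
  intro h0
  have h := pow_raising_spikeBasis_of_le K hE 0 (k := n) (by simp)
  rw [h0, LinearMap.zero_apply, eq_comm, smul_eq_zero] at h
  rcases h with h | h
  · apply hfac
    rwa [show ((((0 : Fin (n + 1)) : ℕ) + 1).ascFactorial n : ℕ) = n.factorial by rw [Fin.val_zero, zero_add, Nat.one_ascFactorial]] at h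
  · exact (spikeBasis K n).ne_zero _ h

include hH in
/-- **the torus commutes with the weight operator: `SbC(a 0 0 d)·h = h·SbC(a 0 0 d)`** (both are diagonal in th-7's spikes). -/
theorem commute_SbC_diag_weight (a d : K) : SbC K a 0 0 d * h = h * SbC K a 0 0 d := by
  refine (spikeBasis K n).ext fun i => ?_
  rw [Module.End.mul_apply, Module.End.mul_apply, hH, map_smul, SbC_diag_spikeBasis, map_smul, hH, smul_smul, smul_smul, mul_comm]

end Triple

end Summit.Ventures.HSemireg.Wedge.HankelFrameChange
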